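import Summits.ABC.ABC.Theses.DefiniteXi
import Summits.ABC.ABC.Theses.RibetTakahashiSplit
import Summits.ABC.ABC.Theses.IsogenyGlueCongruence
import Summits.ABC.ABC.Theorems.IsogenyGlueCongruenceMazurKenkuBoundOfLiteInputs
import Summits.ABC.ABC.Theorems.IsogenyGlueCongruenceMazurKenkuBoundGlue
import Literature.NumberTheory.EllipticCurves.PastenSpectralDegree
import Literature.NumberTheory.EllipticCurves.PastenSpectralDegreeIsogenyBoundProofs
import Literature.NumberTheory.EllipticCurves.PastenHeightBoundsLemma68LocalProofs
import Literature.NumberTheory.EllipticCurves.QuadraticTwistTateFormProofs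
import Literature.NumberTheory.EllipticCurves.OpenImageMazurTwistProofs
import Literature.NumberTheory.EllipticCurves.OpenImageMazurInertiaThreeProofs
import Literature.NumberTheory.EllipticCurves.MultiplicativeUnipotentTorsionProofs
import Literature.NumberTheory.EllipticCurves.SemistableModPImageMultiplicativeProofs
import Literature.NumberTheory.EllipticCurves.KernelReductionTateFormTorsionProofs
import Literature.NumberTheory.EllipticCurves.GoodReductionUnramifiedProofs
import Literature.NumberTheory.EllipticCurves.RationalIsogenyDegreesProofs
import HarnessLib

/-!
# Stub-ideation k=1 (gen 3) for `stub_pasten163` — crux `DefiniteRTControlPrime`, route DefiniteXi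

Scratch check that the helper statements of `STUB-IDEAS-stub_pasten163-1.md` (gen 3) elaborate.
HOME FAMILY 1 — RECOGNISE & IMPORT. Gen 3 adds, over gen 1/2 (files
`STUB_IDEAS_stub_pasten163_1.lean`, `STUB_IDEAS_stub_pasten163_1g2.lean`):

* Plan A: the stub is CLOSED TODAY modulo exactly the three printed inputs of the landed closer
  `Theorems.mazurKenkuBound_of_cor44_of_jTables_of_liteLevels6` (checked below, by name);
* Plan B (the Mazur-free `N^ε` diameter): an IMPORT MAP — every helper of gen 1/2 is a pointwise
  copy / one-parameter port of a NAMED tree theorem: H1 = `PastenShimura2024_minimalDegree_le_163_mul_of`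
  (163 ↦ B) ∘ `pastenShimura_minimalDegree_le_163_mul_of_radius` (radius localised to the class) ∘
  `IsIsogenous.exists_isCyclic`; H2 = five lines over `exists_ordMinimalDiscriminant_mul_eq_mul_of_isCyclic`;
  H5c (multiplicative `v ∤ ℓ`) = the proof of `smul_smul_sub_eq_of_mem_inertia_of_hasMultiplicativeReductionAt`
  with its last linear-algebra step `(M-1)² = 0` replaced by the line-relative form PROVED here
  (`exists_mulVec_sub_eq_smul_of_mulVec_eq_of_det_eq_one`); H5c (`v ∣ ℓ`) = port of
  `exists_addSubgroup_card_le_of_hasMultiplicativeReductionAt` through `TateForm.card_addSubgroup_le_pow (m := k)`;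
  H5c± = H5c on a quadratic twist (`exists_hasMultiplicativeReductionAt_quadraticTwist_of_one_lt_valuation_j`,
  `exists_addEquiv_geomPoints_quadraticTwist_signed`); pot. good `2` = `pow_twelve_smul_eq_of_mem_inertia_of_valuation_j_le_one_of_three`;
  good `v ∤ ℓ` = `smul_geomPoints_eq_of_mem_inertia`.
-/

-- `Summit.ABC.ABC` is the mandated summit-side namespace; the duplicate is deliberate.
set_option linter.dupNamespace false
set_option linter.unusedSimpArgs false

namespace Summit.ABC.ABC.Cruxes.DefiniteRTControlPrime.Sketch.Ideas1g3

open Summit.ABC.ABC.Theses.DefiniteXi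
open Literature.NumberTheory.EllipticCurves Literature.NumberTheory.EllipticCurves.ModularForms
open Literature.NumberTheory.GaloisRepresentations
open WeierstrassCurve IsDedekindDomain NumberField Field

/-! ## Plan A — recognise: the stub is the shared item `MazurKenkuBound` (stmt-ABC-15125) -/

example : Summit.ABC.ABC.Theses.IsogenyGlueCongruence.MazurKenkuBound ↔
    PastenShimura2024_minimalDegree_le_163_mul := Iff.rfl

/-- **Plan A, today's exact residual (2026-08-31).** The stub from the THREE printed inputs of the
landed closer of line `radius-lite` (`IsogenyGlueCongruenceMazurKenkuBoundOfLiteInputs`, sorry-free):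
Mazur's Cor. 4.4 (item stmt-ABC-18223), the ten `j`-tables and the six smooth levels (item
stmt-ABC-18224). Zero helper lemmas. -/
theorem stub_pasten163_of_cor44_of_jTables_of_liteLevels6
    (h44 : Mazur1978.cor44_valuation_j_le_one)
    (hT : ∀ (V V' : WeierstrassCurve ℚ) [V.IsElliptic] [V'.IsElliptic] (ψ : Isogeny V V'),
      ψ.IsCyclic → ψ.degree ∈ ({11, 15, 17, 19, 21, 27, 37, 43, 67, 163} : Finset ℕ) →
        (ψ.degree, V.j) ∈ kenkuIsogenyJTable)
    (hL : ∀ (V V' : WeierstrassCurve ℚ) [V.IsElliptic] [V'.IsElliptic] (ψ : Isogeny V V'),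
      ψ.IsCyclic → ψ.degree ∉ ({26, 35, 49, 65, 125, 169} : Finset ℕ)) :
    PastenShimura2024_minimalDegree_le_163_mul :=
  Summit.ABC.ABC.Theorems.mazurKenkuBound_of_cor44_of_jTables_of_liteLevels6 h44 hT hL

/-- Plan A via the radius item alone (stmt-ABC-15193; Edixhoven integrality discharged). -/
theorem stub_pasten163_of_radius
    (hRad : Summit.ABC.ABC.Theses.RibetTakahashiSplit.MazurKenkuRadius) :
    PastenShimura2024_minimalDegree_le_163_mul :=
  Summit.ABC.ABC.Theorems.mazurKenkuBound_of_radiusItem hRad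

/-! ## Plan B import map — H1: `163 ↦ B`, pointwise, from two named tree proofs -/

/-- **H1a** (S–M; pointwise copy of `PastenShimura2024_minimalDegree_le_163_mul_of` with `163 ↦ B`).
Uses only `degree_eichlerShimuraMap_le_modularDegree`, `exists_modularDegree_holds` and
`modularDegree_eq_card_ker_mul_of_eichlerShimuraMap`; NOTE: neither `W'.IsGloballyMinimal` nor the
`f`-class minimality of `D` (the stub's second hypothesis) is needed — only the minimality of `D'`
among the data of `W'`. -/
theorem modularDegree_le_mul_of_latticeIndex (B : ℕ) {N : ℕ} [NeZero N]
    {W W' : WeierstrassCurve ℚ} [W.IsElliptic] [W'.IsElliptic]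
    (D : ModularParametrizationData W N) (D' : ModularParametrizationData W' N) (hf : D'.f = D.f)
    (hk : ∃ (k : ℤ) (hk : ∀ z ∈ periodLattice D'.f, (k : ℂ) * z ∈ D'.L.lattice), k ≠ 0 ∧
      Nat.card (mulQuotientMap (periodLattice D'.f) D'.L.lattice.toAddSubgroup (k : ℂ) hk).ker ≤ B)
    (hD' : ∀ D'' : ModularParametrizationData W' N, D'.modularDegree ≤ D''.modularDegree) :
    D'.modularDegree ≤ B * D.modularDegree := by
  sorry

/-- **H1b** (M; copy of the body of `Theorems.pastenShimura_minimalDegree_le_163_mul_of_radius`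
with `163 ↦ B` and the radius LOCALISED, two-sidedly, to the `ℚ`-isogeny class of `W'` — it is
applied there to the short models `C₀ • W₀ ~ W'` and `C' • W'`; `hInt` is discharged as in
`mazurKenkuBound_of_radiusItem` by `edixhovenIntegrality_proof`). -/
theorem exists_latticeIndex_le_of_classRadius (B : ℕ) {N : ℕ} [NeZero N]
    {W' : WeierstrassCurve ℚ} [W'.IsElliptic] [W'.IsGloballyMinimal]
    (D' : ModularParametrizationData W' N)
    (hRad : ∀ (W₁ W₂ : WeierstrassCurve ℚ) [W₁.IsElliptic] [W₂.IsElliptic],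
      IsIsogenous W' W₁ → IsIsogenous W' W₂ → ∃ φ : Isogeny W₁ W₂, φ.degree ≤ B) :
    ∃ (k : ℤ) (hk : ∀ z ∈ periodLattice D'.f, (k : ℂ) * z ∈ D'.L.lattice), k ≠ 0 ∧
      Nat.card (mulQuotientMap (periodLattice D'.f) D'.L.lattice.toAddSubgroup (k : ℂ) hk).ker
        ≤ B := by
  sorry

/-- **H1c** (S, proved): a bound on CYCLIC isogenies inside the class is a two-sided class radius
(`IsIsogenous.exists_isCyclic`, AEC III.4.11). This is the form in which gen-1's `FreyIsogenyDiameter`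
feeds H1b. -/
theorem classRadius_of_cyclicDiameter (B : ℕ) {W' : WeierstrassCurve ℚ} [W'.IsElliptic]
    (hDiam : ∀ (W₁ W₂ : WeierstrassCurve ℚ) [W₁.IsElliptic] [W₂.IsElliptic],
      IsIsogenous W' W₁ → IsIsogenous W' W₂ → ∀ φ : Isogeny W₁ W₂, φ.IsCyclic → φ.degree ≤ B)
    (W₁ W₂ : WeierstrassCurve ℚ) [W₁.IsElliptic] [W₂.IsElliptic]
    (h₁ : IsIsogenous W' W₁) (h₂ : IsIsogenous W' W₂) : ∃ φ : Isogeny W₁ W₂, φ.degree ≤ B := by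
  obtain ⟨ψ, hψ⟩ := (h₁.symm_of_charZero.trans' h₂).exists_isCyclic
  exact ⟨ψ, hDiam W₁ W₂ h₁ h₂ ψ hψ⟩

/-- **H1** (assembled, S given H1a–H1c): the parametric `h163` of the lead's skeleton. -/
theorem modularDegree_le_mul_of_cyclicDiameter (B : ℕ) {N : ℕ} [NeZero N]
    {W W' : WeierstrassCurve ℚ} [W.IsElliptic] [W'.IsElliptic] [W'.IsGloballyMinimal]
    (hDiam : ∀ (W₁ W₂ : WeierstrassCurve ℚ) [W₁.IsElliptic] [W₂.IsElliptic],
      IsIsogenous W' W₁ → IsIsogenous W' W₂ → ∀ φ : Isogeny W₁ W₂, φ.IsCyclic → φ.degree ≤ B)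
    (D : ModularParametrizationData W N) (D' : ModularParametrizationData W' N) (hf : D'.f = D.f)
    (hD' : ∀ D'' : ModularParametrizationData W' N, D'.modularDegree ≤ D''.modularDegree) :
    D'.modularDegree ≤ B * D.modularDegree :=
  modularDegree_le_mul_of_latticeIndex B D D' hf
    (exists_latticeIndex_le_of_classRadius B D' (classRadius_of_cyclicDiameter B hDiam)) hD'

/-! ## Plan B import map — H2: valuation transport from the Tate balance (Lemma 6.8 local form) -/

/-- **H2′** (S, proved): at a common multiplicative place a cyclic isogeny of degree `≤ B` changes
`ord_v Δ_min` by a factor `≤ B` — five lines over the landed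
`exists_ordMinimalDiscriminant_mul_eq_mul_of_isCyclic` (`c_v(W)·b = c_v(W')·a`, `ab ∣ deg`).
The Frey-class `hval` of the skeleton is this at the place of an odd `q ∣ N` (multiplicative for
every curve of the class: `isSemistableAt_freyCurve_holds`, `hasMultiplicativeReductionAt_of_isIsogenous`). -/
theorem ordMinimalDiscriminant_le_mul_of_isCyclic {W W' : WeierstrassCurve ℚ} [W.IsElliptic]
    [W'.IsElliptic] (φ : Isogeny W W') (hφ : φ.IsCyclic) {B : ℕ} (hB : φ.degree ≤ B)
    (v : HeightOneSpectrum ℤ) (hv : W.HasMultiplicativeReductionAt v)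
    (hv' : W'.HasMultiplicativeReductionAt v) :
    W'.ordMinimalDiscriminant v ≤ B * W.ordMinimalDiscriminant v := by
  obtain ⟨a, b, ha, hb, hab, h⟩ :=
    exists_ordMinimalDiscriminant_mul_eq_mul_of_isCyclic φ.degree φ hφ rfl v hv hv'
  have hbB : b ≤ B := (Nat.le_of_dvd φ.degree_pos ((Dvd.intro_left a rfl).trans hab)).trans hB
  calc W'.ordMinimalDiscriminant v ≤ W'.ordMinimalDiscriminant v * a :=
        Nat.le_mul_of_pos_right _ ha
    _ = W.ordMinimalDiscriminant v * b := h.symm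
    _ ≤ W.ordMinimalDiscriminant v * B := Nat.mul_le_mul_left _ hbB
    _ = B * W.ordMinimalDiscriminant v := Nat.mul_comm _ _

/-! ## Plan B import map — H5c: the line-relative `(1 *; 0 1)` shape at multiplicative places -/

section Matrix
open Matrix

/-- **H5ℓa** (S, proved; the one genuinely new line of algebra). A `2 × 2` matrix of determinant
`1` fixing a vector `c` with a unit entry moves EVERY vector inside the line `R ∙ c`:
`M x - x ∈ R c`. This is the strengthening of the tree's
`mul_self_sub_one_eq_zero_of_mulVec_eq_of_det_eq_one` (`(M - 1)² = 0`) that the split-pair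
exactness lemma H5a needs (a COMMON cyclic `Λ = ⟨P₁⟩` for all of inertia), cf. k2's objection:
`(τ-1)² = 0` alone allows `τ = 1 + ℓ^{k/2}`. [folklore] -/
theorem exists_mulVec_sub_eq_smul_of_mulVec_eq_of_det_eq_one {R : Type*} [CommRing R]
    (M : Matrix (Fin 2) (Fin 2) R) (c : Fin 2 → R) (hc : IsUnit (c 0) ∨ IsUnit (c 1))
    (hMc : M *ᵥ c = c) (hdet : M.det = 1) (x : Fin 2 → R) :
    ∃ s : R, M *ᵥ x - x = s • c := by
  have h1 : M 0 0 * c 0 + M 0 1 * c 1 = c 0 := by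
    have := congrFun hMc 0
    simpa [Matrix.mulVec, dotProduct, Fin.sum_univ_two] using this
  have h2 : M 1 0 * c 0 + M 1 1 * c 1 = c 1 := by
    have := congrFun hMc 1
    simpa [Matrix.mulVec, dotProduct, Fin.sum_univ_two] using this
  rw [Matrix.det_fin_two] at hdet
  rcases hc with hx | hy
  · obtain ⟨S, hS⟩ := hx.exists_left_inv
    -- `M = (1 - b t, b; -b t², 1 + b t)`, `b = M 0 1`, `t = S * c 1`
    have hM00 : M 0 0 = 1 - M 0 1 * (S * c 1) := by
      linear_combination S * h1 - (M 0 0 - 1) * hS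
    have hM10 : M 1 0 = S * c 1 * (1 - M 1 1) := by
      linear_combination S * h2 - M 1 0 * hS
    have hM11 : M 1 1 = 1 + M 0 1 * (S * c 1) := by
      linear_combination hdet - M 1 1 * hM00 + M 0 1 * hM10
    refine ⟨S * (M 0 1 * (x 1 - S * c 1 * x 0)), ?_⟩
    ext i
    fin_cases i
    · simp [Matrix.mulVec, dotProduct, Fin.sum_univ_two]
      linear_combination x 0 * hM00 - (M 0 1 * (x 1 - S * c 1 * x 0)) * hS
    · simp [Matrix.mulVec, dotProduct, Fin.sum_univ_two]
      linear_combination x 0 * hM10 + (x 1 - S * c 1 * x 0) * hM11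
  · obtain ⟨S, hS⟩ := hy.exists_left_inv
    -- the same with the roles of the two coordinates exchanged: `b = M 1 0`, `t = S * c 0`
    have hM11 : M 1 1 = 1 - M 1 0 * (S * c 0) := by
      linear_combination S * h2 - (M 1 1 - 1) * hS
    have hM01 : M 0 1 = S * c 0 * (1 - M 0 0) := by
      linear_combination S * h1 - M 0 1 * hS
    have hM00 : M 0 0 = 1 + M 1 0 * (S * c 0) := by
      linear_combination hdet - M 0 0 * hM11 + M 1 0 * hM01
    refine ⟨S * (M 1 0 * (x 0 - S * c 0 * x 1)), ?_⟩
    ext i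
    fin_cases i
    · simp [Matrix.mulVec, dotProduct, Fin.sum_univ_two]
      linear_combination x 1 * hM01 + (x 0 - S * c 0 * x 1) * hM00
    · simp [Matrix.mulVec, dotProduct, Fin.sum_univ_two]
      linear_combination x 1 * hM11 - (M 1 0 * (x 0 - S * c 0 * x 1)) * hS


/-- Quick refutation 3 of the md, in Lean: `(τ-1)² = 0 ∧ det τ = 1` does NOT force an exact side on a
split pair — `τ = diag(4,7)` on `(ℤ/9)²` — so H5c∤ must export the common fixed point `P₁`. -/
example : (!![4, 0; 0, 7] : Matrix (Fin 2) (Fin 2) (ZMod 9)).det = 1 := by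
  rw [Matrix.det_fin_two]; decide

example : ((!![4, 0; 0, 7] : Matrix (Fin 2) (Fin 2) (ZMod 9)) - 1) *
    ((!![4, 0; 0, 7] : Matrix (Fin 2) (Fin 2) (ZMod 9)) - 1) = 0 := by
  ext i j
  fin_cases i <;> fin_cases j <;>
    simp [Matrix.mul_apply, Fin.sum_univ_two, Matrix.one_apply] <;> decide

end Matrix

/-- **H5c∤** (M; multiplicative place `v ∤ ℓ`, level `ℓᵏ`; gen-2's `exists_lambda_of_multiplicative`
restricted to `v ∤ ℓ` and RE-SOURCED): copy steps (i) "a point `P₁ ∈ E₀` of order `ℓᵏ` fixed by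
all of `I_𝔐`" and (ii) "`det τ = χ_{ℓᵏ}(τ) = 1`" of the landed
`smul_smul_sub_eq_of_mem_inertia_of_hasMultiplicativeReductionAt` (`MultiplicativeUnipotentTorsionProofs`,
steps named in its module docstring), replace step (iii) by H5ℓa, and globalise exactly as
`smul_smul_sub_eq_of_mem_inertia_geomPoints` does; `Λ = ⟨P₁⟩` is cyclic of order `ℓᵏ`, so
`#Λ[ℓ] = ℓ`. -/
theorem exists_lambda_of_multiplicative_of_not_mem (W : WeierstrassCurve ℚ) [W.IsElliptic]
    (ℓ k : ℕ) [Fact ℓ.Prime] (hk : 1 ≤ k) {v : HeightOneSpectrum (𝓞 ℚ)}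
    (hℓv : (ℓ : 𝓞 ℚ) ∉ v.asIdeal) (hmult : W.HasMultiplicativeReductionAt v)
    {𝔓 : Ideal (absIntegers (𝓞 ℚ) ℚ)} (h𝔓 : 𝔓 ∈ v.primesAbove) :
    ∃ Λ : AddSubgroup (geomPoints W), Λ ≤ geomTorsion W ((ℓ : ℤ) ^ k) ∧
      Set.ncard {x : geomPoints W | x ∈ Λ ∧ (ℓ : ℤ) • x = 0} ≤ ℓ ∧
      ∀ τ ∈ 𝔓.inertia (absoluteGaloisGroup ℚ), ∀ P ∈ geomTorsion W ((ℓ : ℤ) ^ k),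
        τ • P - P ∈ Λ := by
  sorry

/-- **H5c∣** (M; multiplicative place `v ∣ ℓ`, `ℓ ≠ 2`, level `ℓᵏ`): port of the landed
`exists_addSubgroup_card_le_of_hasMultiplicativeReductionAt` (`E[p]`, `v ∣ p`) with `p ↦ ℓᵏ`:
`Λ` = the `ℓᵏ`-torsion in the kernel of reduction of the Tate form of invariant `j`; the two
cardinality facts are `TateForm.card_addSubgroup_le_pow … (m := k)` and `(m := 1)` (already stated
for prime POWERS in `KernelReductionTateFormTorsionProofs`), the inertia step is level-free. -/
theorem exists_lambda_of_multiplicative_of_mem (W : WeierstrassCurve ℚ) [W.IsElliptic]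
    (ℓ k : ℕ) [Fact ℓ.Prime] (hℓ2 : ℓ ≠ 2) {v : HeightOneSpectrum (𝓞 ℚ)}
    (hℓv : (ℓ : 𝓞 ℚ) ∈ v.asIdeal) (hmult : W.HasMultiplicativeReductionAt v)
    {𝔓 : Ideal (absIntegers (𝓞 ℚ) ℚ)} (h𝔓 : 𝔓 ∈ v.primesAbove) :
    ∃ Λ : AddSubgroup (geomPoints W), Λ ≤ geomTorsion W ((ℓ : ℤ) ^ k) ∧
      Set.ncard {x : geomPoints W | x ∈ Λ ∧ (ℓ : ℤ) • x = 0} ≤ ℓ ∧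
      ∀ τ ∈ 𝔓.inertia (absoluteGaloisGroup ℚ), ∀ P ∈ geomTorsion W ((ℓ : ℤ) ^ k),
        τ • P - P ∈ Λ := by
  sorry

/-- **H5c±** (S given H5c∤; pot. multiplicative `v ∤ ℓ` — for the Frey class only `v = 2`):
TRANSPORT, not a new port: a quadratic twist `W^{(d)}` is multiplicative at `v`
(`exists_hasMultiplicativeReductionAt_quadraticTwist_of_one_lt_valuation_j`), H5c∤ gives its line
`Λ^{(d)}`, and the signed equivariant `W^{(d)}(K̄) ≃+ W(K̄)`
(`exists_addEquiv_geomPoints_quadraticTwist_signed`) carries it to `Λ` with `τ • P ∓ P ∈ Λ`. -/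
theorem exists_lambda_sign_of_one_lt_valuation_j (W : WeierstrassCurve ℚ) [W.IsElliptic]
    (ℓ k : ℕ) [Fact ℓ.Prime] (hk : 1 ≤ k) {v : HeightOneSpectrum (𝓞 ℚ)}
    (hℓv : (ℓ : 𝓞 ℚ) ∉ v.asIdeal) (hj : 1 < v.valuation ℚ W.j)
    {𝔓 : Ideal (absIntegers (𝓞 ℚ) ℚ)} (h𝔓 : 𝔓 ∈ v.primesAbove) :
    ∃ Λ : AddSubgroup (geomPoints W), Λ ≤ geomTorsion W ((ℓ : ℤ) ^ k) ∧
      Set.ncard {x : geomPoints W | x ∈ Λ ∧ (ℓ : ℤ) • x = 0} ≤ ℓ ∧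
      ∀ τ ∈ 𝔓.inertia (absoluteGaloisGroup ℚ), ∃ e : ℤ, (e = 1 ∨ e = -1) ∧
        ∀ P ∈ geomTorsion W ((ℓ : ℤ) ^ k), τ • P - e • P ∈ Λ := by
  sorry

/-! ## Aside (not load-bearing): full rational `2`-torsion quadruples odd cyclic degrees -/

/-- **H9** (aside, S–M): if `E/ℚ` has full rational `2`-torsion (the Frey curve does) and a
rational cyclic isogeny of ODD degree `d`, its class carries a rational cyclic isogeny of degree
`4d` (`E/⟨P₁⟩ → E → E/(⟨P₂⟩ + C)`: the dual `2`-isogeny maps `(E/⟨P₁⟩)[2]` onto `⟨P₁⟩ ≠ ⟨P₂⟩`, so the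
`2`-part of the composite kernel is cyclic of order `4`). With the PROVED level `20`
(`isogeny_isCyclic_degree_ne_twenty_holds`) Frey classes have no rational `5`-isogeny, Mazur-free;
under Kenku's list the Frey-class diameter is `≤ 48`, not `163²`. Tools:
`exists_isogeny_ker_eq_and_comp_eq_nsmul_holds`, `Isogeny.exists_isCyclic_degree_eq_of_dvd`. -/
theorem exists_isCyclic_degree_eq_four_mul {E E' : WeierstrassCurve ℚ} [E.IsElliptic]
    [E'.IsElliptic] (h2 : ∀ σ : absoluteGaloisGroup ℚ, ∀ P ∈ geomTorsion E (2 : ℤ), σ • P = P)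
    (φ : Isogeny E E') (hφ : φ.IsCyclic) (hodd : Odd φ.degree) :
    ∃ (E₁ E₂ : WeierstrassCurve ℚ) (_ : E₁.IsElliptic) (_ : E₂.IsElliptic) (ψ : Isogeny E₁ E₂),
      IsIsogenous E E₁ ∧ ψ.IsCyclic ∧ ψ.degree = 4 * φ.degree := by
  sorry

end Summit.ABC.ABC.Cruxes.DefiniteRTControlPrime.Sketch.Ideas1g3
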